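import Mathlib
import HarnessLib

/-!
# Crux `BirBdGPhaseCoercivity` (stmt-HubbardSuperconductivity-2081, route `BalabanIR`), line
`bcs-dual-persistence` (reshaped, `V := K`) — stub `stub_defectBound` (S6, the exact defect of the pair
symbol and its imaginary-part minorant)

For `E > 0` bounded by `E_max`, `|Δ| ≤ Δ_max` (`Δ_max > 0`) on a finite abelian group `G` and `q ∈ G`:
`Σ_k [|Δ_k|²/E_k - |Δ_k+Δ_{k+q}|²/(2(E_k+E_{k+q}))] ≥ (4Δ_max²E_max)⁻¹ Σ_k (Im(conj(Δ_k) Δ_{k+q}))²`.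
Proof: reindex `Σ_k |Δ_{k+q}|²/(2E_{k+q}) = Σ_k |Δ_k|²/(2E_k)` (`Equiv.addRight q`), so the left side is
`Σ_k [|z|²/(2a) + |w|²/(2b) - |z+w|²/(2(a+b))]` with `z = Δ_k, w = Δ_{k+q}, a = E_k, b = E_{k+q}`; termwise
`|z|²/(2a) + |w|²/(2b) - |z+w|²/(2(a+b)) = |bz - aw|²/(2ab(a+b))` (exact) and
`|bz - aw|² |z| |w| ≥ a b (Im(z̄ w))²` (`Im(Z̄W) = Im(Z̄(W-Z))` gives `|Im Z̄W| ≤ |Z| |W-Z|`, and symmetrically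
`≤ |W| |Z-W|`; multiply), whence each term is `≥ (Im z̄w)²/(2|z||w|(a+b)) ≥ (Im z̄w)²/(4Δ_max²E_max)`
(the case `z = 0` or `w = 0` is trivial since then `Im z̄w = 0`).
No definition is introduced. [folklore]
-/

noncomputable section

set_option linter.dupNamespace false

namespace Summit.HubbardSuperconductivity.HubbardSuperconductivity.Theorems.BirBdGPhaseCoercivity

open Finset
open scoped ComplexConjugate

/-- `|Im(Z̄ W)| ≤ |Z| · |W - Z|`, since `Z̄ W = Z̄ (W - Z) + |Z|²` and `|Z|²` is real. [folklore] -/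
private lemma defectBound_abs_im_le_left (Z W : ℂ) :
    |(conj Z * W).im| ≤ ‖Z‖ * ‖W - Z‖ := by
  have h : (conj Z * W).im = (conj Z * (W - Z)).im := by
    simp only [Complex.mul_im, Complex.conj_re, Complex.conj_im, Complex.sub_re, Complex.sub_im]
    ring
  rw [h]
  calc |(conj Z * (W - Z)).im| ≤ ‖conj Z * (W - Z)‖ := Complex.abs_im_le_norm _
    _ = ‖Z‖ * ‖W - Z‖ := by rw [norm_mul, Complex.norm_conj]

/-- `|Im(Z̄ W)| ≤ |W| · |Z - W|`, the symmetric companion of the previous bound. [folklore] -/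
private lemma defectBound_abs_im_le_right (Z W : ℂ) :
    |(conj Z * W).im| ≤ ‖W‖ * ‖Z - W‖ := by
  have h : (conj Z * W).im = -(conj W * (Z - W)).im := by
    simp only [Complex.mul_im, Complex.conj_re, Complex.conj_im, Complex.sub_re, Complex.sub_im]
    ring
  rw [h, abs_neg]
  calc |(conj W * (Z - W)).im| ≤ ‖conj W * (Z - W)‖ := Complex.abs_im_le_norm _
    _ = ‖W‖ * ‖Z - W‖ := by rw [norm_mul, Complex.norm_conj]

/-- `(Im(Z̄ W))² ≤ |Z| |W| |Z - W|²` (product of the two one-sided bounds). [folklore] -/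
private lemma defectBound_im_sq_le (Z W : ℂ) :
    (conj Z * W).im ^ 2 ≤ ‖Z‖ * ‖W‖ * ‖Z - W‖ ^ 2 := by
  have h1 := defectBound_abs_im_le_left Z W
  have h2 := defectBound_abs_im_le_right Z W
  rw [norm_sub_rev W Z] at h1
  have h12 := mul_le_mul h1 h2 (abs_nonneg _) (by positivity)
  calc (conj Z * W).im ^ 2 = |(conj Z * W).im| * |(conj Z * W).im| := by rw [← sq, sq_abs]
    _ ≤ ‖Z‖ * ‖Z - W‖ * (‖W‖ * ‖Z - W‖) := h12
    _ = ‖Z‖ * ‖W‖ * ‖Z - W‖ ^ 2 := by ring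

/-- Scaled form: `a b (Im(z̄ w))² ≤ |z| |w| |b z - a w|²` for `a, b > 0`. [folklore] -/
private lemma defectBound_scaled_im_sq_le (z w : ℂ) {a b : ℝ} (ha : 0 < a) (hb : 0 < b) :
    a * b * (conj z * w).im ^ 2 ≤ ‖z‖ * ‖w‖ * ‖(b : ℂ) * z - (a : ℂ) * w‖ ^ 2 := by
  have h := defectBound_im_sq_le ((b : ℂ) * z) ((a : ℂ) * w)
  have him : (conj ((b : ℂ) * z) * ((a : ℂ) * w)).im = a * b * (conj z * w).im := by
    simp only [Complex.mul_im, Complex.mul_re, Complex.conj_re, Complex.conj_im,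
      Complex.ofReal_re, Complex.ofReal_im]
    ring
  have hZ : ‖(b : ℂ) * z‖ = b * ‖z‖ := by
    rw [norm_mul, Complex.norm_of_nonneg hb.le]
  have hW : ‖(a : ℂ) * w‖ = a * ‖w‖ := by
    rw [norm_mul, Complex.norm_of_nonneg ha.le]
  rw [him, hZ, hW] at h
  have hab : 0 < a * b := mul_pos ha hb
  have key : a * b * (a * b * (conj z * w).im ^ 2) ≤
      a * b * (‖z‖ * ‖w‖ * ‖(b : ℂ) * z - (a : ℂ) * w‖ ^ 2) := by
    calc a * b * (a * b * (conj z * w).im ^ 2) = (a * b * (conj z * w).im) ^ 2 := by ring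
      _ ≤ b * ‖z‖ * (a * ‖w‖) * ‖(b : ℂ) * z - (a : ℂ) * w‖ ^ 2 := h
      _ = a * b * (‖z‖ * ‖w‖ * ‖(b : ℂ) * z - (a : ℂ) * w‖ ^ 2) := by ring
  exact le_of_mul_le_mul_left key hab

/-- The exact defect identity
`|z|²/(2a) + |w|²/(2b) - |z+w|²/(2(a+b)) = |b z - a w|²/(2ab(a+b))` for `a, b > 0`. [folklore] -/
private lemma defectBound_identity (z w : ℂ) {a b : ℝ} (ha : 0 < a) (hb : 0 < b) :
    ‖z‖ ^ 2 / (2 * a) + ‖w‖ ^ 2 / (2 * b) - ‖z + w‖ ^ 2 / (2 * (a + b)) =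
      ‖(b : ℂ) * z - (a : ℂ) * w‖ ^ 2 / (2 * a * b * (a + b)) := by
  simp only [Complex.sq_norm, Complex.normSq_apply, Complex.add_re, Complex.add_im, Complex.sub_re,
    Complex.sub_im, Complex.mul_re, Complex.mul_im, Complex.ofReal_re, Complex.ofReal_im]
  have ha' : a ≠ 0 := ha.ne'
  have hb' : b ≠ 0 := hb.ne'
  have hab' : a + b ≠ 0 := (add_pos ha hb).ne'
  field_simp
  ring

/-- Termwise bound: `(4Δ_max²E_max)⁻¹ (Im(z̄ w))² ≤ |z|²/(2a) + |w|²/(2b) - |z+w|²/(2(a+b))`. [folklore] -/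
private lemma defectBound_term (z w : ℂ) {a b Dm Em : ℝ} (ha : 0 < a) (hb : 0 < b) (hDm : 0 < Dm)
    (haE : a ≤ Em) (hbE : b ≤ Em) (hz : ‖z‖ ≤ Dm) (hw : ‖w‖ ≤ Dm) :
    (4 * Dm ^ 2 * Em)⁻¹ * (conj z * w).im ^ 2 ≤
      ‖z‖ ^ 2 / (2 * a) + ‖w‖ ^ 2 / (2 * b) - ‖z + w‖ ^ 2 / (2 * (a + b)) := by
  rw [defectBound_identity z w ha hb, inv_mul_eq_div]
  set X : ℝ := ‖(b : ℂ) * z - (a : ℂ) * w‖ ^ 2 with hXdef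
  have hX : 0 ≤ X := by positivity
  have hEm : 0 < Em := ha.trans_le haE
  have hB := defectBound_scaled_im_sq_le z w ha hb
  have hzw : ‖z‖ * ‖w‖ ≤ Dm * Dm := mul_le_mul hz hw (norm_nonneg _) hDm.le
  have h1 : a * b * (conj z * w).im ^ 2 ≤ Dm * Dm * X :=
    hB.trans (mul_le_mul_of_nonneg_right hzw hX)
  have h2 : (conj z * w).im ^ 2 * (2 * a * b * (a + b)) ≤ X * (4 * Dm ^ 2 * Em) := by
    have hab2 : a + b ≤ 2 * Em := by linarith
    have h3 : 2 * (a + b) * (a * b * (conj z * w).im ^ 2) ≤ 2 * (a + b) * (Dm * Dm * X) :=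
      mul_le_mul_of_nonneg_left h1 (by positivity)
    have h4 : 2 * (a + b) * (Dm * Dm * X) ≤ 2 * (2 * Em) * (Dm * Dm * X) :=
      mul_le_mul_of_nonneg_right (by linarith) (by positivity)
    calc (conj z * w).im ^ 2 * (2 * a * b * (a + b))
        = 2 * (a + b) * (a * b * (conj z * w).im ^ 2) := by ring
      _ ≤ 2 * (2 * Em) * (Dm * Dm * X) := h3.trans h4
      _ = X * (4 * Dm ^ 2 * Em) := by ring
  exact (div_le_div_iff₀ (by positivity) (by positivity)).2 h2

/-- **Exact defect of the pair symbol and its imaginary-part minorant.** [folklore] -/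
theorem stub_defectBound {G : Type*} [AddCommGroup G] [Fintype G] (Δ : G → ℂ) (E : G → ℝ)
    (Dm Em : ℝ) (hEpos : ∀ k, 0 < E k) (hEle : ∀ k, E k ≤ Em) (hDm : 0 < Dm)
    (hΔle : ∀ k, ‖Δ k‖ ≤ Dm) (q : G) :
    (4 * Dm ^ 2 * Em)⁻¹ * ∑ k, ((starRingEnd ℂ) (Δ k) * Δ (k + q)).im ^ 2 ≤
      ∑ k, (‖Δ k‖ ^ 2 / E k - ‖Δ k + Δ (k + q)‖ ^ 2 / (2 * (E k + E (k + q)))) := by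
  have key : ∀ k, (4 * Dm ^ 2 * Em)⁻¹ * (conj (Δ k) * Δ (k + q)).im ^ 2 ≤
      ‖Δ k‖ ^ 2 / (2 * E k) + ‖Δ (k + q)‖ ^ 2 / (2 * E (k + q)) -
        ‖Δ k + Δ (k + q)‖ ^ 2 / (2 * (E k + E (k + q))) := fun k =>
    defectBound_term (Δ k) (Δ (k + q)) (hEpos k) (hEpos (k + q)) hDm (hEle k) (hEle (k + q))
      (hΔle k) (hΔle (k + q))
  have hre : ∑ k, ‖Δ (k + q)‖ ^ 2 / (2 * E (k + q)) = ∑ k, ‖Δ k‖ ^ 2 / (2 * E k) :=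
    Fintype.sum_equiv (Equiv.addRight q) _ _ (fun _ => rfl)
  calc (4 * Dm ^ 2 * Em)⁻¹ * ∑ k, (conj (Δ k) * Δ (k + q)).im ^ 2
      = ∑ k, (4 * Dm ^ 2 * Em)⁻¹ * (conj (Δ k) * Δ (k + q)).im ^ 2 := Finset.mul_sum _ _ _
    _ ≤ ∑ k, (‖Δ k‖ ^ 2 / (2 * E k) + ‖Δ (k + q)‖ ^ 2 / (2 * E (k + q)) -
          ‖Δ k + Δ (k + q)‖ ^ 2 / (2 * (E k + E (k + q)))) := Finset.sum_le_sum (fun k _ => key k)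
    _ = ∑ k, ‖Δ k‖ ^ 2 / (2 * E k) + ∑ k, ‖Δ (k + q)‖ ^ 2 / (2 * E (k + q)) -
          ∑ k, ‖Δ k + Δ (k + q)‖ ^ 2 / (2 * (E k + E (k + q))) := by
        rw [Finset.sum_sub_distrib, Finset.sum_add_distrib]
    _ = ∑ k, ‖Δ k‖ ^ 2 / (2 * E k) + ∑ k, ‖Δ k‖ ^ 2 / (2 * E k) -
          ∑ k, ‖Δ k + Δ (k + q)‖ ^ 2 / (2 * (E k + E (k + q))) := by rw [hre]
    _ = ∑ k, (‖Δ k‖ ^ 2 / E k - ‖Δ k + Δ (k + q)‖ ^ 2 / (2 * (E k + E (k + q)))) := by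
        rw [← Finset.sum_add_distrib, ← Finset.sum_sub_distrib]
        refine Finset.sum_congr rfl (fun k _ => ?_)
        ring

end Summit.HubbardSuperconductivity.HubbardSuperconductivity.Theorems.BirBdGPhaseCoercivity

end
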